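/-
Copyright: the b2b-balaban T⁴-continuum CRUX team, row NE7b leaf lineage `t4-ne7b-formalise-leaf-05` (gen 152). Project licence.
-/
import Summits.QuantumFields.BalabanUV.T4Continuum.Spine.NE7b.ScalarTowerFibreFloor
import Summits.QuantumFields.BalabanUV.T4Continuum.Spine.NE7b.CoerciveFluctuationFloor
import Summits.QuantumFields.BalabanUV.T4Continuum.Spine.NE7b.FibreWindowHessianBounds
import Summits.QuantumFields.BalabanUV.T4Continuum.Spine.NE7b.ConvexWindowSuppliers

/-!
# THE SCALAR TOWER's PERTURBED GAUSSIAN FIBRE, END DISPLAY WITH `λ` A NUMBER: for `V(x, z) = ⟪z, M̂ z⟫ + P(x, z)`,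
# `M = ½ · reindex e e (aL⁻²Q^*_jQ_j + Δ^{(j)})` (Bałaban's scalar torus tower, ANY enumeration `e` of the sites), and a perturbation `P`
# with Hessian letters `(−h; a₀, a₁; b)` on a convex bounded fibre window `F`:
# `a₀ − b²∕(gamma115u L a − h) ≤ D²V⁺(x)[u, u] ≤ a₁`, `V⁺ = −log ∫_F e^{−V(·, z)} dz` — «Hessian in ⟹ Hessian out» across one fluctuation
# integral (`…FibreWindowHessianBounds` §9) with the fibre floor BY VALUE (`…ScalarTowerFibreFloor` §4) through the Gaussian-plus-perturbation
# feeder (`…CoerciveFluctuationFloor` §4) (row NE7b, node U5c; residual (R2′) family (2), letter (ℓ1); junction theorems)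

Cell `pub-balaban`, sub-cell `t4`, spine estimate NE7b (`T4WeightBudget.RelWeightBound`; the cell's OWN estimate — NOT PRINTED in
[Bałaban 1983–89], NOT PROVED).  Crux-route work under `Spine/NE7b/`; NOTHING of Bałaban's is asserted (the one analytic input is the tree's
(1.15) on the torus, through `…ScalarTowerFibreFloor.coercive_Carg_reindex`); no `def`; zero `sorry`.  Three junctions BY NAME, no new estimate:
* §1 **`hessian_twoSided_scalarTowerFibre`** — the END display above: `…ScalarTowerFibreFloor.coercive_Carg_reindex` + `coercive_smul_of_nonneg`
  (the `½`) + `isSymm_Carg_reindex` ⊢ `…CoerciveFluctuationFloor.coercive_iff_inner ∕ inner_toEuclideanCLM_symm` (operator letters, `σ = γ₀∕2`)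
  ⊢ `…CoerciveFluctuationFloor.hessianLetters_quadratic_snd_add` (the four letters, fibre floor `2σ − h = γ₀ − h`)
  ⊢ `…FibreWindowHessianBounds.hessian_twoSided_of_hessianLetters`.
* §2 **`firstOrderOn_scalarTowerQuadratic_add`** — the OWNER's windowed first-order letter
  (`…ConvexWindowSuppliers.firstOrderOn_quadratic_add_of_hessianOn`) for `⟪·, M̂·⟫ + P` ON a convex window `K`, modulus `gamma115u L a − h`.
* §3 `hessian_lower_scalarTowerQuadratic` — `…CoerciveFluctuationFloor.hessian_lower_of_coercive` at the by-value matrix: floor `gamma115u L a`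
  for `⟪·, M̂·⟫` in the road's `Fin N` currency, everywhere.

NOT HERE (honest): the letters `(h; a₀, a₁; b)` of `P` by value (for which `P`, on which window, in which chart — (A3) ∕ (A1c), NC-NE7b-α
UNRULED; `…AnalyticHessianLetter` ∕ `…PlaquetteCubic*` supply SHAPES); the gauge-covariant fluctuation forms (G-B9-09 ∕ G-an2-4); anything of
Bałaban's beyond (1.15) for the scalar prototype.  BY-NAME EFFECT ON THE WALL: NONE.  NE7b NOT PRINTED ∕ NOT PROVED; spine PROVED 0∕9;
rung (B)+1 on ONE finite T⁴ — NOT infinite volume, NOT the mass gap, NOT Clay.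
HONEST DEPENDENCY: continuum YM on T⁴ ⇐ BetaPertH ∧ nine spine estimates (0/9 proved); BetaPertH ⇐ (D1) ∧ (D4) ∧ CAP+tail.
-/

set_option autoImplicit false
noncomputable section
open Real InnerProductSpace Set Matrix MeasureTheory Metric Bornology
open scoped RealInnerProductSpace

namespace Summit.QuantumFields.BalabanUV.T4Continuum.NE7b.ScalarTowerPerturbedFibre

open Summit.QuantumFields.BalabanUV.T4Continuum.NE7b
open Literature.MathematicalPhysics.QuantumFieldTheory.Balaban1983to89
open Literature.MathematicalPhysics.QuantumFieldTheory.Balaban1983to89.B4Ineq115Torus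
open Literature.MathematicalPhysics.QuantumFieldTheory.Balaban1983to89 (QGQInverse.Coercive)

variable (P : Params)

/-- The by-value matrix letters of the HALVED, RE-INDEXED fibre operator `M = ½ · reindex e e (Carg P a m² j)` in the road's `Fin N` currency:
`M` is `(gamma115u L a)∕2`-coercive and symmetric. [junction] -/
theorem coercive_isSymm_half_Carg_reindex {a msq : ℝ} (ha : 0 < a) (hm : 0 ≤ msq) {j N : ℕ} (hj : 1 ≤ j) (e : Site P j ≃ Fin N) :
    QGQInverse.Coercive ((1 / 2 : ℝ) • reindex e e (Carg P a msq j)) (1 / 2 * gamma115u P.L a) ∧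
      ((1 / 2 : ℝ) • reindex e e (Carg P a msq j)).IsSymm :=
  ⟨ScalarTowerFibreFloor.coercive_smul_of_nonneg (by norm_num) (ScalarTowerFibreFloor.coercive_Carg_reindex P ha hm hj e),
    (ScalarTowerFibreFloor.isSymm_Carg_reindex P a msq e).smul _⟩

/-! ## §1 The END display across one fluctuation integral, fibre floor by value -/

/-- **THE SCALAR TOWER's PERTURBED GAUSSIAN FIBRE — HESSIAN IN, HESSIAN OUT, `λ` A NUMBER.**  `P : Params` (dimension, odd `L > 1`, volume,
cutoff), `0 < a`, `0 ≤ m²`, level `1 ≤ j`, ANY enumeration `e : Site P j ≃ Fin N` of the fluctuation sites, `M := ½ · reindex e e (Carg P a m² j)`;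
a perturbation `Pt ∈ C²` on `ℝᵐ × ℝᴺ` with, on the convex measurable bounded fibre window `F` (`volume F ≠ 0`) through the base point `x`:
fibre letter `−h‖v‖² ≤ D²(Pt(x,·))(y)[v,v]`, base block `a₀ ≤ D²Pt(x,y)[(u,0),(u,0)] ≤ a₁`, mixed block `|D²Pt(x,y)[(0,v),(u,0)]| ≤ b‖v‖`
(`b ≥ 0`), and `gamma115u L a − h > 0`.  THEN for `V(x, z) = ⟪z, M̂ z⟫ + Pt(x, z)`:
`a₀ − b²∕(gamma115u L a − h) ≤ D²V⁺(x)[u,u] ≤ a₁`, `V⁺ = −log ∫_F e^{−V(·,z)} dz`. [junction of tree theorems by name] -/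
theorem hessian_twoSided_scalarTowerFibre {a msq : ℝ} (ha : 0 < a) (hm : 0 ≤ msq) {j N m : ℕ} (hj : 1 ≤ j) (e : Site P j ≃ Fin N)
    {h : ℝ} (hlam : 0 < gamma115u P.L a - h)
    {Pt : EuclideanSpace ℝ (Fin m) × EuclideanSpace ℝ (Fin N) → ℝ} (hP : ContDiff ℝ 2 Pt)
    {F : Set (EuclideanSpace ℝ (Fin N))} (hFc : Convex ℝ F) (hF : MeasurableSet F) (hFb : IsBounded F) (hF0 : volume F ≠ 0)
    (x u : EuclideanSpace ℝ (Fin m)) {a₀ a₁ b : ℝ} (hb0 : 0 ≤ b)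
    (hfibP : ∀ y ∈ F, ∀ v : EuclideanSpace ℝ (Fin N), -h * ‖v‖ ^ 2 ≤ iteratedFDeriv ℝ 2 (fun z => Pt (x, z)) y ![v, v])
    (haP : ∀ y ∈ F, a₀ ≤ fderiv ℝ (fderiv ℝ Pt) (x, y) (u, 0) (u, 0))
    (hAP : ∀ y ∈ F, fderiv ℝ (fderiv ℝ Pt) (x, y) (u, 0) (u, 0) ≤ a₁)
    (hbP : ∀ y ∈ F, ∀ v : EuclideanSpace ℝ (Fin N), |fderiv ℝ (fderiv ℝ Pt) (x, y) (0, v) (u, 0)| ≤ b * ‖v‖) :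
    a₀ - b ^ 2 / (gamma115u P.L a - h) ≤ iteratedFDeriv ℝ 2 (fun x => -log (∫ y in F, exp (-
        (fun p : EuclideanSpace ℝ (Fin m) × EuclideanSpace ℝ (Fin N) =>
          ⟪p.2, toEuclideanCLM (𝕜 := ℝ) ((1 / 2 : ℝ) • reindex e e (Carg P a msq j)) p.2⟫ + Pt p) (x, y)))) x ![u, u] ∧
      iteratedFDeriv ℝ 2 (fun x => -log (∫ y in F, exp (-
        (fun p : EuclideanSpace ℝ (Fin m) × EuclideanSpace ℝ (Fin N) =>
          ⟪p.2, toEuclideanCLM (𝕜 := ℝ) ((1 / 2 : ℝ) • reindex e e (Carg P a msq j)) p.2⟫ + Pt p) (x, y)))) x ![u, u] ≤ a₁ := by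
  obtain ⟨hC, hS⟩ := coercive_isSymm_half_Carg_reindex P ha hm hj e
  have hσ := (CoerciveFluctuationFloor.coercive_iff_inner _ _).1 hC
  have hA := CoerciveFluctuationFloor.inner_toEuclideanCLM_symm hS
  obtain ⟨h1, h2, h3, h4⟩ :=
    CoerciveFluctuationFloor.hessianLetters_quadratic_snd_add _ hA hσ hP x u hfibP haP hAP hbP
  have e2 : 2 * (1 / 2 * gamma115u P.L a) - h = gamma115u P.L a - h := by ring
  rw [e2] at h1
  exact FibreWindowHessianBounds.hessian_twoSided_of_hessianLetters (CoerciveFluctuationFloor.contDiff_quadratic_snd_add _ hP)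
    hFc hF hFb hF0 hlam x u h1 hb0 h2 h3 h4

/-! ## §2 The OWNER's windowed first-order letter at the by-value matrix -/

/-- **FIRST-ORDER LETTER ON A WINDOW, MODULUS `gamma115u L a − h`**: for `⟪·, M̂·⟫ + Pt` with `Pt ∈ C²` and `−h‖v‖² ≤ D²Pt` on a convex `K`:
`(⟪x,M̂x⟫ + Pt x) + ⟪∇(⟪·,M̂·⟫ + Pt)(x), y − x⟫ + ((gamma115u L a − h)∕2)‖y − x‖² ≤ ⟪y,M̂y⟫ + Pt y` for `x, y ∈ K` —
`…ConvexWindowSuppliers.firstOrderOn_quadratic_add_of_hessianOn` BY NAME. [junction] -/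
theorem firstOrderOn_scalarTowerQuadratic_add {a msq : ℝ} (ha : 0 < a) (hm : 0 ≤ msq) {j N : ℕ} (hj : 1 ≤ j) (e : Site P j ≃ Fin N)
    {h : ℝ} {K : Set (EuclideanSpace ℝ (Fin N))} (hK : Convex ℝ K) {Pt : EuclideanSpace ℝ (Fin N) → ℝ} (hP : ContDiff ℝ 2 Pt)
    (hH : ∀ x ∈ K, ∀ v : EuclideanSpace ℝ (Fin N), -h * ‖v‖ ^ 2 ≤ iteratedFDeriv ℝ 2 Pt x ![v, v]) :
    ∀ x ∈ K, ∀ y ∈ K, (⟪x, toEuclideanCLM (𝕜 := ℝ) ((1 / 2 : ℝ) • reindex e e (Carg P a msq j)) x⟫ + Pt x) +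
        ⟪gradient (fun z : EuclideanSpace ℝ (Fin N) =>
          ⟪z, toEuclideanCLM (𝕜 := ℝ) ((1 / 2 : ℝ) • reindex e e (Carg P a msq j)) z⟫ + Pt z) x, y - x⟫ +
        (gamma115u P.L a - h) / 2 * ‖y - x‖ ^ 2 ≤
        ⟪y, toEuclideanCLM (𝕜 := ℝ) ((1 / 2 : ℝ) • reindex e e (Carg P a msq j)) y⟫ + Pt y := by
  obtain ⟨hC, hS⟩ := coercive_isSymm_half_Carg_reindex P ha hm hj e
  have key := ConvexWindowSuppliers.firstOrderOn_quadratic_add_of_hessianOn _ hK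
    (CoerciveFluctuationFloor.inner_toEuclideanCLM_symm hS) ((CoerciveFluctuationFloor.coercive_iff_inner _ _).1 hC) hP hH
  have e2 : (2 * (1 / 2 * gamma115u P.L a) - h) = gamma115u P.L a - h := by ring
  rw [e2] at key
  exact key

/-! ## §3 The Hessian floor in the road's `Fin N` currency -/

/-- **HESSIAN FLOOR `gamma115u L a` EVERYWHERE** for `⟪·, M̂·⟫`, `M = ½ · reindex e e (Carg P a m² j)` — `…CoerciveFluctuationFloor.hessian_lower_of_coercive`
at the by-value matrix. [junction] -/
theorem hessian_lower_scalarTowerQuadratic {a msq : ℝ} (ha : 0 < a) (hm : 0 ≤ msq) {j N : ℕ} (hj : 1 ≤ j) (e : Site P j ≃ Fin N)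
    (x v : EuclideanSpace ℝ (Fin N)) :
    gamma115u P.L a * ‖v‖ ^ 2 ≤
      iteratedFDeriv ℝ 2 (fun z : EuclideanSpace ℝ (Fin N) =>
        ⟪z, toEuclideanCLM (𝕜 := ℝ) ((1 / 2 : ℝ) • reindex e e (Carg P a msq j)) z⟫) x ![v, v] := by
  obtain ⟨hC, hS⟩ := coercive_isSymm_half_Carg_reindex P ha hm hj e
  have key := CoerciveFluctuationFloor.hessian_lower_of_coercive hS hC x v
  linarith

end Summit.QuantumFields.BalabanUV.T4Continuum.NE7b.ScalarTowerPerturbedFibre
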